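import Mathlib
import HarnessLib

/-!
# Crux `BirComplexStableXYR`, line `fat-gaussian-defect-calculus`: stub T10 `stub_traceRankOne`

Registered stub (lead c8, wave 13, chapter T-end, skeleton
`Cruxes/BirComplexStableXYR/Lines/fat_gaussian_defect_calculus.lean`), helper (`--supports`) for the crux
`Summit.HubbardSuperconductivity.HubbardSuperconductivity.Theses.BalabanIR.BirComplexStableXYR`:
**the dressed rank-one projector has trace one** (generic finite-dimensional linear algebra).

**Statement.** Let `E` be a finite-dimensional complex inner product space, `x : E`, `ψ : E →L[ℂ] ℂ` with
`ψ x ≠ 0`, and let `p := (ψ x)⁻¹ • ψ(·) x : E →L[ℂ] E` be the dressed rank-one projector of the T-end lemma.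
Then `tr p = 1`.  (This turns the power formula `tⁿ = μⁿ p + (small)` into `tr tⁿ = μⁿ + (small)`.)

**Proof.** The underlying linear map of `(ψ x)⁻¹ • ψ.smulRight x` is `(ψ x)⁻¹ • (ψ.toLinearMap.smulRight x)`
(`ContinuousLinearMap.toLinearMap_smul`; the second coercion is definitional), the trace is linear (`map_smul`), the
trace of the rank-one map `y ↦ ψ y • x` is `ψ x` (Mathlib `LinearMap.trace_smulRight`), and
`(ψ x)⁻¹ * ψ x = 1` (`inv_mul_cancel₀`).  Elementary given Mathlib; no definition and no named fact is
introduced; sorry-free. [folklore]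
-/

set_option linter.dupNamespace false -- `Summit.<S>.<S>.Theorems…` repeats the summit name (D-0017 layout)

namespace Summit.HubbardSuperconductivity.HubbardSuperconductivity.Theorems.TEnd

/-- The underlying linear map of the continuous rank-one map `ψ.smulRight x` (`y ↦ ψ y • x`) is the
algebraic rank-one map `ψ.toLinearMap.smulRight x` (definitional). [folklore] -/
theorem hsc_traceRankOne_coe_smulRight {E : Type*} [NormedAddCommGroup E] [NormedSpace ℂ E] (x : E)
    (ψ : E →L[ℂ] ℂ) : ((ψ.smulRight x : E →L[ℂ] E) : E →ₗ[ℂ] E) = (ψ : E →ₗ[ℂ] ℂ).smulRight x :=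
  rfl

/-- **Trace of a rank-one map** (continuous version of `LinearMap.trace_smulRight`): on a
finite-dimensional complex normed space, `tr (y ↦ ψ y • x) = ψ x`. [folklore] -/
theorem hsc_traceRankOne_trace_smulRight {E : Type*} [NormedAddCommGroup E] [NormedSpace ℂ E]
    [FiniteDimensional ℂ E] (x : E) (ψ : E →L[ℂ] ℂ) :
    LinearMap.trace ℂ E ((ψ.smulRight x : E →L[ℂ] E) : E →ₗ[ℂ] E) = ψ x := by
  rw [hsc_traceRankOne_coe_smulRight, LinearMap.trace_smulRight, ContinuousLinearMap.coe_coe]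

/-- **stub T10 (S, generic): the dressed rank-one projector has trace one** (`tr(ψ(·)x) = ψ(x)`).
For `ψ x ≠ 0`, the operator `p := (ψ x)⁻¹ • ψ(·) x` on a finite-dimensional complex inner product space has
`tr p = (ψ x)⁻¹ * ψ x = 1` (linearity of the trace and `LinearMap.trace_smulRight`). [folklore] -/
theorem stub_traceRankOne :
    ∀ (E : Type) [NormedAddCommGroup E] [InnerProductSpace ℂ E] [FiniteDimensional ℂ E] (x : E) (ψ : E →L[ℂ] ℂ),
      ψ x ≠ 0 → LinearMap.trace ℂ E (((ψ x)⁻¹ • ψ.smulRight x : E →L[ℂ] E) : E →ₗ[ℂ] E) = 1 := by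
  intro E _ _ _ x ψ hψ
  rw [ContinuousLinearMap.toLinearMap_smul, map_smul, hsc_traceRankOne_trace_smulRight, smul_eq_mul,
    inv_mul_cancel₀ hψ]

end Summit.HubbardSuperconductivity.HubbardSuperconductivity.Theorems.TEnd
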